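import Literature.NumberTheory.LFunctions.LagariasXiStructureFunction
import HarnessLib

/-!
# [Su23b] Proposition 3.1 discharged: `Θ_ξ` meromorphic inner ⟺ `E_ξ` Hermite–Biehler ⟺ RH

LINE 1 — LABELS. `Suzuki2023b_prop31` (M. Suzuki, J. Number Theory 252 (2023) = arXiv:2301.05779,
Prop. 3.1, p. 7: «(1) RH ⟺ (2) `E = ξ(½−iz)+ξ′(½−iz)` is in the Hermite–Biehler class ⟺ (3)
`Θ = E♯/E` is a meromorphic inner function for `ℂ₊`») is RH-EQUIVALENT, PRINTED; this module
PROVES it (`Suzuki2023b_prop31_holds`), following the printed proof: (1)⟺(2) is [La06] Thm. 1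
(`Lagarias2006_thm1_holds`, sibling module); (2)⟹(3) «`Θ` has norm one on the real axis, is
analytic in `ℂ₊`, and is bounded» (here: the a.e. boundary limit holds off the real zeros of `E_ξ`,
a Lebesgue-null set — `ae_lagariasE_ofReal_ne_zero`); (3)⟹(1) by the printed contradiction «a zero
`z₀ ∈ ℂ₊` of `ξ(½ − iz)` gives `Θ(z₀) = −1`» (`tendsto_lagariasTheta_of_lagariasXiA_eq_zero`, for a
zero of ANY multiplicity, as a punctured limit), where the printed input «(3) implies `|Θ| < 1` on
`ℂ₊`» (de Branges' representation of meromorphic inner functions — not in Mathlib) is replaced, for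
THIS `Θ`, by the Phragmén–Lindelöf principle on a half-plane (`|Θ| ≤ 1` on `ℝ` unconditionally,
`Θ` bounded on `ℂ₊`; `norm_lagariasTheta_le_one_of_differentiableOn`) and the maximum modulus
principle (`|Θ(z₀)| = 1` at an interior point forces `Θ ≡ −1`, i.e. `ξ ≡ 0` — absurd). Every
theorem here is either RH-FREE (algebra/analysis of `E_ξ`, `Θ`, `A`) or an RH-FREE lemma about the
RH-EQUIVALENT criterion; `IsHermiteBiehler lagariasE` / `IsMeromorphicInnerUHP lagariasTheta` are
NEVER asserted (Conrey–Li guard R7 of the cell rh-crit/dbl). A kernel-checked criterion fixes WHICH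
property of `Θ_ξ` would prove RH; it does not move RH. WHAT THIS IS NOT: not a route, not a proof
plan for RH, no positivity asserted; nothing here bears on the truth of RH.

Source: [Su23b] held text `paper:arxiv-2301.05779`, chunk p0007 L95–135, p0008 L1–4 (`Suzuki2023b`).
Inputs: Mathlib's `analyticOrderAt` factorisations, `PhragmenLindelof.right_half_plane_of_bounded_on_real`,
`Complex.eqOn_of_isPreconnected_of_isMaxOn_norm`, `ae_restrict_le_codiscreteWithin`; the tree's
`lagariasE`/`lagariasTheta`/`norm_lagariasTheta_ofReal(_le_one)` and the sibling statement module.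
-/

noncomputable section

open Complex Filter Set MeasureTheory
open scoped ComplexConjugate Topology

namespace Literature.NumberTheory.LFunctions

open Literature.Analysis.DeBrangesSpaces

/-! ## Analytic bookkeeping for `A(z) = ξ(½ − iz)` ([Su23b] (3.3)) -/

/-- `A(z) = ξ(½ − iz)` is entire. RH-FREE. [cite: Suzuki2023b, §3.3, eq. (3.3), p. 7–8] -/
theorem differentiable_lagariasXiA : Differentiable ℂ lagariasXiA := by
  have h : lagariasXiA = fun z ↦ riemannXi (1 / 2 - I * z) := funext lagariasXiA_eq
  rw [h]
  exact differentiable_riemannXi.comp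
    ((differentiable_const _).sub ((differentiable_const _).mul differentiable_id))

/-- Chain rule: `ξ′(½ − iz) = i·A′(z)` (the derivative `ξ′` EVALUATED at `½ − iz`, [Su23b] (3.1),
versus the derivative of `z ↦ ξ(½ − iz)`). RH-FREE. [cite: Suzuki2023b, §3.2, eq. (3.1), p. 7 L99–101] -/
theorem deriv_riemannXi_eq_I_mul_deriv_lagariasXiA (z : ℂ) :
    deriv riemannXi (1 / 2 - I * z) = I * deriv lagariasXiA z := by
  have h : lagariasXiA = fun z ↦ riemannXi (1 / 2 - I * z) := funext lagariasXiA_eq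
  have h1 : HasDerivAt (fun w : ℂ ↦ (1 / 2 : ℂ) - I * w) (-I) z := by
    have := ((hasDerivAt_id z).const_mul I).const_sub (1 / 2 : ℂ)
    simpa using this
  have h2 : HasDerivAt (fun w ↦ riemannXi (1 / 2 - I * w))
      (deriv riemannXi (1 / 2 - I * z) * (-I)) z :=
    (differentiable_riemannXi _).hasDerivAt.comp z h1
  rw [h, h2.deriv]
  linear_combination (deriv riemannXi (1 / 2 - I * z)) * I_mul_I

/-- `E_ξ = A + i A′` (`E = A − iB` with `B = −A′`). RH-FREE. [cite: Suzuki2023b, §3.2–3.3, eqs. (3.1), (3.3), p. 7] -/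
theorem lagariasE_eq_A_add_I_mul_deriv (z : ℂ) :
    lagariasE z = lagariasXiA z + I * deriv lagariasXiA z := by
  rw [lagariasE_eq_lagariasXiA_add, deriv_riemannXi_eq_I_mul_deriv_lagariasXiA]

/-- `E_ξ♯ = A − i A′`. RH-FREE. [cite: Suzuki2023b, §3.3, p. 8 L1–2] -/
theorem sharp_lagariasE_eq_A_sub_I_mul_deriv (z : ℂ) :
    sharp lagariasE z = lagariasXiA z - I * deriv lagariasXiA z := by
  rw [sharp_lagariasE, ← lagariasXiA_eq, deriv_riemannXi_eq_I_mul_deriv_lagariasXiA]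

/-- `Θ = (A − iA′)/(A + iA′)`. RH-FREE. [cite: Suzuki2023b, §3.2, eq. (3.2), p. 7] -/
theorem lagariasTheta_eq_div (z : ℂ) :
    lagariasTheta z =
      (lagariasXiA z - I * deriv lagariasXiA z) / (lagariasXiA z + I * deriv lagariasXiA z) := by
  unfold lagariasTheta
  rw [sharp_lagariasE_eq_A_sub_I_mul_deriv, lagariasE_eq_A_add_I_mul_deriv]

/-- `A(i) = ξ(3/2) ≠ 0`: `A` is not the zero function. RH-FREE.
[cite: Suzuki2023b, §3.3, p. 8 L1 (A(z) = ξ(1/2 − iz))] -/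
theorem lagariasXiA_I_ne_zero : lagariasXiA I ≠ 0 := by
  rw [lagariasXiA_eq]
  have h : (1 / 2 : ℂ) - I * I = ((3 / 2 : ℝ) : ℂ) := by
    rw [I_mul_I]; push_cast; ring
  rw [h]
  exact riemannXi_ne_zero_of_one_le_re (by rw [Complex.ofReal_re]; norm_num)

/-- `A` does not vanish identically near any point (identity theorem; `A(i) ≠ 0`). RH-FREE.
[cite: Suzuki2023b, §3.3, p. 8 L1 (A(z) = ξ(1/2 − iz))] -/
theorem lagariasXiA_not_eventually_zero (z₀ : ℂ) : ¬ (∀ᶠ z in 𝓝 z₀, lagariasXiA z = 0) := by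
  intro h
  have hA : AnalyticOnNhd ℂ lagariasXiA Set.univ := fun z _ ↦ differentiable_lagariasXiA.analyticAt z
  have hz : EqOn lagariasXiA 0 Set.univ :=
    hA.eqOn_zero_of_preconnected_of_eventuallyEq_zero isPreconnected_univ (Set.mem_univ z₀) h
  exact lagariasXiA_I_ne_zero (hz (Set.mem_univ I))

/-- The zeros of `E_ξ` are isolated: near every point, `E_ξ ≠ 0` on a punctured neighbourhood
(`E_ξ ≢ 0`, since `A = (E_ξ + E_ξ♯)/2 ≢ 0`). RH-FREE.
[cite: Suzuki2023b, §3.2, eq. (3.1), p. 7 (E entire)] -/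
theorem lagariasE_eventually_ne_zero (z₀ : ℂ) : ∀ᶠ z in 𝓝[≠] z₀, lagariasE z ≠ 0 := by
  rcases (differentiable_lagariasE.analyticAt z₀).eventually_eq_zero_or_eventually_ne_zero with h | h
  · exfalso
    have hEan : AnalyticOnNhd ℂ lagariasE Set.univ := fun z _ ↦ differentiable_lagariasE.analyticAt z
    have hE : EqOn lagariasE 0 Set.univ :=
      hEan.eqOn_zero_of_preconnected_of_eventuallyEq_zero isPreconnected_univ (Set.mem_univ z₀) h
    apply lagariasXiA_I_ne_zero
    unfold lagariasXiA
    rw [sharp_apply, hE (Set.mem_univ _), hE (Set.mem_univ _)]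
    simp
  · exact h

/-! ## The local behaviour `Θ → −1` at the zeros of `A` ([Su23b] Prop. 3.1, proof of (3)⟹(2)) -/

/-- **`Θ(z) → −1` as `z → z₀` (punctured) at every zero `z₀` of `A(z) = ξ(½ − iz)`**, of ANY
multiplicity: writing `A = (z − z₀)^{n+1} g`, `A′ = (z − z₀)^n h` with `g(z₀), h(z₀) ≠ 0`,
`Θ = ((z−z₀)g − ih)/((z−z₀)g + ih) → −1`. This is the printed step «by writing
`ξ(1/2 − iz) = c(z − z₀)^m F(z)` … we see `Θ(z₀) = −1`» of [Su23b] (there for `z₀ ∈ ℂ₊`; here for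
all `z₀`, as a punctured limit, which is insensitive to Lean's junk value of `Θ` at zeros of `E_ξ`).
RH-FREE. [cite: Suzuki2023b, Prop. 3.1 (proof of (3)⇒(2)), p. 7 L112–121] -/
theorem tendsto_lagariasTheta_of_lagariasXiA_eq_zero {z₀ : ℂ} (h0 : lagariasXiA z₀ = 0) :
    Tendsto lagariasTheta (𝓝[≠] z₀) (𝓝 (-1)) := by
  have hA : AnalyticAt ℂ lagariasXiA z₀ := differentiable_lagariasXiA.analyticAt z₀
  have hne_top : analyticOrderAt lagariasXiA z₀ ≠ ⊤ := by
    rw [Ne, analyticOrderAt_eq_top]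
    exact lagariasXiA_not_eventually_zero z₀
  obtain ⟨N, hN⟩ := ENat.ne_top_iff_exists.mp hne_top
  have hN0 : N ≠ 0 := by
    intro hN0
    rw [hN0] at hN
    exact (analyticOrderAt_ne_zero.mpr ⟨hA, h0⟩) (by rw [← hN, Nat.cast_zero])
  obtain ⟨n, rfl⟩ := Nat.exists_eq_succ_of_ne_zero hN0
  -- factorisation of `A` and of `A′`
  obtain ⟨g, hg_an, hg_ne, hg_eq⟩ := hA.analyticOrderAt_eq_natCast.mp hN.symm
  have hderiv_order : analyticOrderAt (deriv lagariasXiA) z₀ = n :=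
    (analyticOrderAt_deriv_eq_iff hA h0).mp (by rw [← hN]; push_cast; rfl)
  obtain ⟨h, hh_an, hh_ne, hh_eq⟩ := hA.deriv.analyticOrderAt_eq_natCast.mp hderiv_order
  -- the model function
  set q : ℂ → ℂ := fun z ↦ ((z - z₀) * g z - I * h z) / ((z - z₀) * g z + I * h z) with hq
  have hq_cont : ContinuousAt q z₀ := by
    have hgc : ContinuousAt g z₀ := hg_an.continuousAt
    have hhc : ContinuousAt h z₀ := hh_an.continuousAt
    have hl : ContinuousAt (fun z : ℂ ↦ z - z₀) z₀ := continuousAt_id.sub continuousAt_const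
    refine ((hl.mul hgc).sub (continuousAt_const.mul hhc)).div
      ((hl.mul hgc).add (continuousAt_const.mul hhc)) ?_
    simpa using mul_ne_zero I_ne_zero hh_ne
  have hq0 : q z₀ = -1 := by
    simp only [hq, sub_self, zero_mul, zero_sub, zero_add]
    rw [neg_div, div_self (mul_ne_zero I_ne_zero hh_ne)]
  -- `Θ = q` on a punctured neighbourhood of `z₀`
  have heq : ∀ᶠ z in 𝓝[≠] z₀, lagariasTheta z = q z := by
    have h1 : ∀ᶠ z in 𝓝[≠] z₀,
        lagariasXiA z = (z - z₀) ^ (n + 1) • g z ∧ deriv lagariasXiA z = (z - z₀) ^ n • h z :=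
      nhdsWithin_le_nhds (hg_eq.and hh_eq)
    filter_upwards [h1, self_mem_nhdsWithin] with z hz1 hz
    obtain ⟨hz1, hz2⟩ := hz1
    have hzz : z - z₀ ≠ 0 := sub_ne_zero.mpr hz
    rw [lagariasTheta_eq_div, hz1, hz2, hq]
    simp only [smul_eq_mul]
    rw [show (z - z₀) ^ (n + 1) * g z - I * ((z - z₀) ^ n * h z) =
          (z - z₀) ^ n * ((z - z₀) * g z - I * h z) by ring,
      show (z - z₀) ^ (n + 1) * g z + I * ((z - z₀) ^ n * h z) =
          (z - z₀) ^ n * ((z - z₀) * g z + I * h z) by ring,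
      mul_div_mul_left _ _ (pow_ne_zero n hzz)]
  have hq_tend : Tendsto q (𝓝[≠] z₀) (𝓝 (-1)) := by
    rw [← hq0]; exact hq_cont.tendsto.mono_left nhdsWithin_le_nhds
  exact hq_tend.congr' (heq.mono fun z hz ↦ hz.symm)

/-! ## (3) ⟹ (1): contractivity by Phragmén–Lindelöf, then the maximum modulus principle -/

/-- If `Θ = E_ξ♯/E_ξ` is analytic and bounded on `ℂ₊` then `|Θ| ≤ 1` on `ℂ₊`. Printed as «(3)
implies `|Θ(z)| < 1` for all `z ∈ ℂ₊`» ([Su23b] p. 7 L112–113, via the de Branges representation of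
meromorphic inner functions, p. 7 L78–80); proved here for THIS `Θ` by the Phragmén–Lindelöf
principle on a half-plane (Mathlib) applied to `Θ` patched to `−1` at the real zeros of `E_ξ`
(where `Θ → −1`, `tendsto_lagariasTheta_of_lagariasXiA_eq_zero`), using only `|Θ| ≤ 1` on `ℝ`
(`norm_lagariasTheta_ofReal_le_one`) and boundedness; the a.e. boundary-value clause of «inner» is
not needed. RH-FREE. [cite: Suzuki2023b, Prop. 3.1 (proof of (3)⇒(2)), p. 7 L112–113] -/
theorem norm_lagariasTheta_le_one_of_differentiableOn
    (hdiff : DifferentiableOn ℂ lagariasTheta {z : ℂ | 0 < z.im})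
    (hbdd : ∃ C : ℝ, ∀ z : ℂ, 0 < z.im → ‖lagariasTheta z‖ ≤ C) {w : ℂ} (hw : 0 < w.im) :
    ‖lagariasTheta w‖ ≤ 1 := by
  classical
  obtain ⟨C, hC⟩ := hbdd
  -- the boundary-patched symbol
  set P : ℂ → ℂ := fun z ↦ if z.im ≤ 0 ∧ lagariasE z = 0 then -1 else lagariasTheta z with hP
  have hP_of_pos : ∀ z : ℂ, 0 < z.im → P z = lagariasTheta z := fun z hz ↦ by
    simp only [hP, not_le.mpr hz, false_and, if_false]
  have hP_of_ne : ∀ z : ℂ, lagariasE z ≠ 0 → P z = lagariasTheta z := fun z hz ↦ by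
    simp only [hP, hz, and_false, if_false]
  have hU : IsOpen {z : ℂ | 0 < z.im} := isOpen_lt continuous_const Complex.continuous_im
  have hΘcont : ∀ z : ℂ, lagariasE z ≠ 0 → ContinuousAt lagariasTheta z := fun z hz ↦
    ((differentiable_sharp differentiable_lagariasE).continuous.continuousAt).div
      continuous_lagariasE.continuousAt hz
  -- continuity of `P` at every point of the closed upper half-plane
  have hPcont : ∀ z : ℂ, 0 ≤ z.im → ContinuousAt P z := by
    intro z hz
    rcases hz.lt_or_eq with hpos | hzero
    · have heq : P =ᶠ[𝓝 z] lagariasTheta := by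
        filter_upwards [hU.mem_nhds hpos] with u hu using hP_of_pos u hu
      exact ((hdiff.differentiableAt (hU.mem_nhds hpos)).continuousAt).congr_of_eventuallyEq heq
    · by_cases hEz : lagariasE z = 0
      · have hzle : z.im ≤ 0 := hzero.symm.le
        have hPz : P z = -1 := by simp only [hP, hzle, hEz, and_self, if_true]
        have hz_real : ((z.re : ℝ) : ℂ) = z := by
          apply Complex.ext
          · simp
          · rw [Complex.ofReal_im, ← hzero]
        have hA0 : lagariasXiA z = 0 := by
          rw [lagariasXiA_eq]
          have h := (lagariasE_ofReal_eq_zero_iff z.re).mp (by rw [hz_real]; exact hEz)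
          rw [hz_real] at h
          exact h.1
        have hlim : Tendsto P (𝓝[≠] z) (𝓝 (P z)) := by
          rw [hPz]
          refine (tendsto_lagariasTheta_of_lagariasXiA_eq_zero hA0).congr' ?_
          filter_upwards [lagariasE_eventually_ne_zero z] with u hu using (hP_of_ne u hu).symm
        exact continuousWithinAt_compl_self.mp hlim
      · have heq : P =ᶠ[𝓝 z] lagariasTheta := by
          filter_upwards [continuous_lagariasE.continuousAt.eventually_ne hEz] with u hu
            using hP_of_ne u hu
        exact (hΘcont z hEz).congr_of_eventuallyEq heq
  -- Phragmén–Lindelöf in the right half-plane for `g(u) = P(iu)`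
  set g : ℂ → ℂ := fun u ↦ P (I * u) with hg
  have hIu_im : ∀ u : ℂ, (I * u).im = u.re := fun u ↦ by simp [Complex.mul_im]
  have hd : DiffContOnCl ℂ g {u : ℂ | 0 < u.re} := by
    refine ⟨?_, ?_⟩
    · have h1 : DifferentiableOn ℂ (fun u ↦ lagariasTheta (I * u)) {u : ℂ | 0 < u.re} :=
        hdiff.comp ((differentiable_const I).mul differentiable_id).differentiableOn
          fun u hu ↦ by simpa [hIu_im] using hu
      exact h1.congr fun u hu ↦ hP_of_pos _ (by rw [hIu_im]; exact hu)
    · rw [closure_setOf_lt_re]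
      exact ContinuousOn.comp (s := {u : ℂ | 0 ≤ u.re}) (t := {z : ℂ | 0 ≤ z.im})
        (fun z hz ↦ (hPcont z hz).continuousWithinAt)
        ((continuous_const.mul continuous_id).continuousOn)
        fun u hu ↦ by simpa [hIu_im] using hu
  have hexp : ∃ c < (2 : ℝ), ∃ B,
      g =O[Bornology.cobounded ℂ ⊓ 𝓟 {u : ℂ | 0 < u.re}] fun u ↦ Real.exp (B * ‖u‖ ^ c) := by
    refine ⟨0, by norm_num, 0, ?_⟩
    simp only [zero_mul, Real.exp_zero]
    refine Asymptotics.IsBigO.of_bound C (Filter.eventually_inf_principal.mpr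
      (Eventually.of_forall fun u hu ↦ ?_))
    have hu' : 0 < (I * u).im := by rw [hIu_im]; exact hu
    rw [norm_one, mul_one, hg]; dsimp only; rw [hP_of_pos _ hu']
    exact hC _ hu'
  have hre : IsBoundedUnder (· ≤ ·) atTop fun x : ℝ ↦ ‖g x‖ := by
    refine isBoundedUnder_of_eventually_le (a := C) ?_
    filter_upwards [eventually_gt_atTop 0] with x hx
    have hx' : 0 < (I * (x : ℂ)).im := by rw [hIu_im]; simpa using hx
    rw [hg]; dsimp only; rw [hP_of_pos _ hx']
    exact hC _ hx'
  have him : ∀ x : ℝ, ‖g (x * I)‖ ≤ 1 := by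
    intro x
    rw [hg]
    dsimp only
    have hx : I * ((x : ℂ) * I) = ((-x : ℝ) : ℂ) := by
      rw [mul_comm (x : ℂ) I, ← mul_assoc, I_mul_I]; push_cast; ring
    rw [hx]
    by_cases hE : lagariasE ((-x : ℝ) : ℂ) = 0
    · have hval : P ((-x : ℝ) : ℂ) = -1 := by
        simp only [hP, Complex.ofReal_im, le_refl, hE, and_self, if_true]
      rw [hval, norm_neg, norm_one]
    · rw [hP_of_ne _ hE]
      exact norm_lagariasTheta_ofReal_le_one _
  have key := PhragmenLindelof.right_half_plane_of_bounded_on_real hd hexp hre him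
    (z := -I * w) (by simp [Complex.mul_re]; exact hw.le)
  have hw' : g (-I * w) = lagariasTheta w := by
    rw [hg]
    dsimp only
    rw [show I * (-I * w) = w by rw [← mul_assoc, mul_neg, I_mul_I, neg_neg, one_mul]]
    exact hP_of_pos w hw
  rwa [hw'] at key

/-- **[Su23b] Prop. 3.1, (3) ⟹ (1)**: if `Θ = E_ξ♯/E_ξ` is a meromorphic inner function for `ℂ₊`
then RH. Printed proof (p. 7 L112–121), followed: a non-real zero of `ξ` gives `z₀ ∈ ℂ₊` with
`A(z₀) = 0`, where `Θ(z₀) = −1` (`tendsto_lagariasTheta_of_lagariasXiA_eq_zero` + continuity),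
against `|Θ| ≤ 1` on `ℂ₊` (`norm_lagariasTheta_le_one_of_differentiableOn`); the printed strict
`|Θ| < 1` is replaced by the maximum modulus principle: `|Θ(z₀)| = 1` forces `Θ ≡ −1` on `ℂ₊`,
i.e. `A ≡ 0` there, contradicting `A(i) = ξ(3/2) ≠ 0`. LABEL: RH-FREE lemma about an
RH-EQUIVALENT criterion (its hypothesis is never available unconditionally); nothing here bears
on the truth of RH. [cite: Suzuki2023b, Prop. 3.1 (3)⇒(1), p. 7 L112–121] -/
theorem riemannHypothesis_of_isMeromorphicInnerUHP (h3 : IsMeromorphicInnerUHP lagariasTheta) :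
    RiemannHypothesis := by
  obtain ⟨hdiff, hbdd, -, -⟩ := h3
  have hle : ∀ z : ℂ, 0 < z.im → ‖lagariasTheta z‖ ≤ 1 := fun z hz ↦
    norm_lagariasTheta_le_one_of_differentiableOn hdiff hbdd hz
  rw [riemannHypothesis_iff_lagariasXiA_zeros_real]
  by_contra hcon
  push Not at hcon
  obtain ⟨z, hz0, hzim⟩ := hcon
  obtain ⟨z₀, hz₀, hA0⟩ : ∃ z₀ : ℂ, 0 < z₀.im ∧ lagariasXiA z₀ = 0 := by
    rcases lt_or_gt_of_ne hzim with h | h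
    · exact ⟨conj z, by rw [Complex.conj_im]; linarith, by rw [lagariasXiA_conj, hz0, map_zero]⟩
    · exact ⟨z, h, hz0⟩
  have hU : IsOpen {z : ℂ | 0 < z.im} := isOpen_lt continuous_const Complex.continuous_im
  have hcont : ContinuousAt lagariasTheta z₀ :=
    (hdiff.differentiableAt (hU.mem_nhds hz₀)).continuousAt
  have hval : lagariasTheta z₀ = -1 :=
    tendsto_nhds_unique (hcont.tendsto.mono_left nhdsWithin_le_nhds)
      (tendsto_lagariasTheta_of_lagariasXiA_eq_zero hA0)
  have hmax : IsMaxOn (norm ∘ lagariasTheta) {z : ℂ | 0 < z.im} z₀ :=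
    isMaxOn_iff.mpr fun w hw ↦ by
      simp only [Function.comp_apply, hval, norm_neg, norm_one]
      exact hle w hw
  have hconst := Complex.eqOn_of_isPreconnected_of_isMaxOn_norm
    (convex_halfSpace_im_gt 0).isPreconnected hU hdiff hz₀ hmax
  have hI : lagariasTheta I = -1 := by
    have := hconst (show (I : ℂ) ∈ {z : ℂ | 0 < z.im} by simp)
    rw [this, Function.const_apply, hval]
  apply lagariasXiA_I_ne_zero
  unfold lagariasTheta at hI
  unfold lagariasXiA
  by_cases hE : lagariasE I = 0
  · rw [hE, div_zero] at hI
    norm_num at hI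
  · rw [div_eq_iff hE] at hI
    rw [hI]
    ring

/-! ## (2) ⟹ (3) -/

/-- `Θ = E_ξ♯/E_ξ` is meromorphic on all of `ℂ` (quotient of entire functions), unconditionally
([Su23b] p. 7 L131–132: «`Θ(z)` in (3.2) is unconditionally meromorphic on `ℂ`»). RH-FREE.
[cite: Suzuki2023b, §3.2, p. 7 L131–132] -/
theorem meromorphicOn_lagariasTheta : MeromorphicOn lagariasTheta Set.univ := fun z _ ↦
  ((differentiable_sharp differentiable_lagariasE).analyticAt z).meromorphicAt.div
    (differentiable_lagariasE.analyticAt z).meromorphicAt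

/-- For almost every real `x`, `E_ξ(x) ≠ 0` (the real zeros of the entire `E_ξ ≢ 0` are isolated,
hence Lebesgue-null; `E_ξ(0) ≠ 0` since `ξ(½) ≠ 0`). RH-FREE.
[cite: Suzuki2023b, §3.2, p. 7 L131–133 («takes absolute value one everywhere on the real axis»)] -/
theorem ae_lagariasE_ofReal_ne_zero : ∀ᵐ x : ℝ, lagariasE (x : ℂ) ≠ 0 := by
  have han : AnalyticOnNhd ℝ (fun x : ℝ ↦ lagariasE (x : ℂ)) Set.univ := fun x _ ↦
    ((differentiable_lagariasE.analyticAt (x : ℂ)).restrictScalars (𝕜 := ℝ)).comp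
      (Complex.ofRealCLM.analyticAt x)
  have h0 : lagariasE ((0 : ℝ) : ℂ) ≠ 0 := by
    rw [Ne, lagariasE_ofReal_eq_zero_iff]
    rintro ⟨h, -⟩
    have h' : riemannXi (1 / 2) = 0 := by simpa using h
    obtain ⟨hζ, -, -⟩ := (riemannXi_eq_zero_iff_holds _).1 h'
    have hne := riemannZeta_ofReal_ne_zero_of_pos_of_lt_one (1 / 2) (by norm_num) (by norm_num)
    push_cast at hne
    exact hne hζ
  have hcod := han.preimage_zero_mem_codiscrete (x := 0) h0
  have hle : ae (volume : Measure ℝ) ≤ Filter.codiscrete ℝ := by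
    have := ae_restrict_le_codiscreteWithin (μ := (volume : Measure ℝ)) MeasurableSet.univ
    rwa [Measure.restrict_univ] at this
  filter_upwards [hle hcod] with x hx
  simpa using hx

/-- **[Su23b] Prop. 3.1, (2) ⟹ (3)**: if `E_ξ` is Hermite–Biehler then `Θ = E_ξ♯/E_ξ` is a
meromorphic inner function for `ℂ₊` — «`Θ(z)` has norm one on the real axis, is analytic in `ℂ₊`,
and is bounded in the upper half-plane, which makes it an inner function» (p. 7 L107–110): analytic
on `ℂ₊` since `E_ξ ≠ 0` there; bounded by `1`; the boundary limit `|Θ(x+iy)| → |Θ(x)| = 1` holds at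
every real `x` with `E_ξ(x) ≠ 0` (continuity), i.e. almost everywhere
(`ae_lagariasE_ofReal_ne_zero`); meromorphic on `ℂ` (`meromorphicOn_lagariasTheta`). RH-FREE lemma
(its hypothesis is an RH-CONSEQUENCE, never asserted). [cite: Suzuki2023b, Prop. 3.1 (2)⇒(3), p. 7 L107–110] -/
theorem isMeromorphicInnerUHP_of_isHermiteBiehler (hE : IsHermiteBiehler lagariasE) :
    IsMeromorphicInnerUHP lagariasTheta := by
  have hΘ : lagariasTheta = fun z ↦ sharp lagariasE z / lagariasE z := rfl
  refine ⟨?_, ⟨1, fun z hz ↦ ?_⟩, ?_, ⟨lagariasTheta, meromorphicOn_lagariasTheta, fun _ _ ↦ rfl⟩⟩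
  · rw [hΘ]
    exact (differentiable_sharp differentiable_lagariasE).differentiableOn.div
      differentiable_lagariasE.differentiableOn fun z hz ↦ hE.ne_zero_of_im_pos hz
  · rw [hΘ]
    dsimp only
    rw [norm_div]
    exact ((div_lt_one (norm_pos_iff.mpr (hE.ne_zero_of_im_pos hz))).mpr (hE.norm_sharp_lt hz)).le
  · filter_upwards [ae_lagariasE_ofReal_ne_zero] with x hx
    have hc : ContinuousAt lagariasTheta x := by
      rw [hΘ]
      exact ((differentiable_sharp differentiable_lagariasE).continuous.continuousAt).div
        continuous_lagariasE.continuousAt hx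
    have hpath : Tendsto (fun y : ℝ ↦ (x : ℂ) + I * y) (𝓝[>] 0) (𝓝 (x : ℂ)) := by
      have hc' : Continuous (fun y : ℝ ↦ (x : ℂ) + I * y) := by fun_prop
      have h0 := hc'.tendsto 0
      simp only [Complex.ofReal_zero, mul_zero, add_zero] at h0
      exact h0.mono_left nhdsWithin_le_nhds
    have hlim := (hc.tendsto.comp hpath).norm
    rw [norm_lagariasTheta_ofReal hx] at hlim
    exact hlim

/-! ## [Su23b] Proposition 3.1, discharged -/

/-- **Discharge of `Suzuki2023b_prop31`** ([Su23b] Prop. 3.1: RH ⟺ `E_ξ` Hermite–Biehler ⟺ `Θ`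
meromorphic inner), assembled as printed: (1)⟺(2) = [La06] Thm. 1 (`Lagarias2006_thm1_holds`),
(2)⟹(3) (`isMeromorphicInnerUHP_of_isHermiteBiehler`), (3)⟹(1)
(`riemannHypothesis_of_isMeromorphicInnerUHP`). LABEL (l.1): RH-EQUIVALENT, PRINTED; a kernel-checked
criterion — it fixes WHICH analytic property of `Θ_ξ` would prove RH and does not move RH.
[cite: Suzuki2023b, Prop. 3.1, p. 7 L95–125] -/
theorem Suzuki2023b_prop31_holds : Suzuki2023b_prop31 := by
  unfold Suzuki2023b_prop31
  tfae_have 1 ↔ 2 := Lagarias2006_thm1_holds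
  tfae_have 2 → 3 := isMeromorphicInnerUHP_of_isHermiteBiehler
  tfae_have 3 → 1 := riemannHypothesis_of_isMeromorphicInnerUHP
  tfae_finish

end Literature.NumberTheory.LFunctions
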